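import Summits.AnomalousDissipation.AnomalousDissipation.Theorems.SawtoothPulseCascadeK1LocalisedCascadeSlotAxisDeriv
import Summits.AnomalousDissipation.AnomalousDissipation.Theorems.SawtoothPulseCascadeK1LocalisedCascadeSlotFlatLeibniz
import Summits.AnomalousDissipation.AnomalousDissipation.Theorems.SawtoothPulseCascadeK1LocalisedCascadeSlotUngauge

/-!
# K1loc, line `Spectral` / SeqCone — helper: THE DERIVATIVE MULTIPLIERS OF THE UN-GAUGING MULTIPLIER (B3b glue)

Helper file of the prover lane on the crux `K1LocalisedCascade` (stmt-AnomalousDissipation-19491), route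
`SawtoothPulseCascade` (NOTES HANDOFF B3b).  The un-gauging multiplier of one strip family on the fibre `k_i = n` is
`Θ(x) = X(x_j) g_n(x_j) e_b(x_j)`, the circle function of `F(y) = X(y)·exp(−2πi n P(y))·exp(2πi b y)`.  With `G_α` the
circle functions of the derivatives `F^{(α)}` (inputs, characterised by `G_α(↑y) = F^{(α)}(y)`), this file supplies
the data the higher-order expansion (`…SlotExpansion`, `…SlotFibreExpansion`) asks for: `G_0(x_j) = Θ(x)`
(`multiplier_eq_G_zero`), smoothness (`isSmooth_comp_eval_G`), the coefficient relation
`𝓕(G_α(x_j))(q) = (2πi q_j)^α 𝓕(Θ)(q)` (`mFourierCoeff_comp_eval_G`), and — when `P' = s` on an open set `U` off which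
`X` vanishes locally (the flat strips) — the sup bounds `‖G_α‖ ≤ B_α` from the flat Leibniz recursion and the
disjointness from any multiplier whose cut-off vanishes on `U` (`norm_comp_eval_G_le`, `conj_comp_eval_G_mul_eq_zero`).
No definitions; no statement about the stub.
[cite: Grafakos2014, Prop. 3.1.2 (5)] [problem: turb]
-/

-- `Summit.<Summit>.<Problem>`: single-conjunct summit, the duplicate namespace segment is deliberate.
set_option linter.dupNamespace false

noncomputable section

namespace Summit.AnomalousDissipation.AnomalousDissipation.Theorems.SawtoothPulseCascade.K1Slot

open MeasureTheory Set Filter Topology UnitAddTorus Complex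
open scoped ContDiff
open Literature.Analysis Literature.Analysis.FunctionSpaces Literature.Analysis.FunctionSpaces.Torus

/-! ## The generating function `F` of the multiplier and its derivatives -/

/-- `F(y) = X(y)·exp(−2πi n P(y))·exp(2πi b y)` is `1`-periodic. [folklore] -/
theorem periodic_multiplierFun (X P : ShearProfile) (n b : ℤ) :
    Function.Periodic (fun y : ℝ => (X y : ℂ) * (cexp (-(2 * Real.pi * I * n * P y)) * cexp (2 * Real.pi * I * b * y))) 1 := by
  intro y
  simp only
  rw [X.periodic y, P.periodic y]
  congr 2
  have h : cexp (2 * Real.pi * I * b) = 1 := by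
    rw [show (2 * Real.pi * I * b : ℂ) = b * (2 * Real.pi * I) by ring]
    exact Complex.exp_int_mul_two_pi_mul_I b
  rw [Complex.ofReal_add, Complex.ofReal_one, mul_add, mul_one, Complex.exp_add, h, mul_one]

/-- `F` is smooth. [folklore] -/
theorem contDiff_multiplierFun (X P : ShearProfile) (n b : ℤ) :
    ContDiff ℝ ∞ (fun y : ℝ => (X y : ℂ) * (cexp (-(2 * Real.pi * I * n * P y)) * cexp (2 * Real.pi * I * b * y))) := by
  have hX : ContDiff ℝ ∞ (fun y : ℝ => (X y : ℂ)) := ofRealCLM.contDiff.comp X.contDiff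
  have hP : ContDiff ℝ ∞ (fun y : ℝ => (P y : ℂ)) := ofRealCLM.contDiff.comp P.contDiff
  have hy : ContDiff ℝ ∞ (fun y : ℝ => (y : ℂ)) := ofRealCLM.contDiff
  refine hX.mul ((Complex.contDiff_exp.comp ?_).mul (Complex.contDiff_exp.comp ?_))
  · exact (contDiff_const.mul hP).neg
  · exact contDiff_const.mul hy

/-- The phase `φ(y) = exp(−2πi n P(y))·exp(2πi b y)` satisfies `φ' = 2πi(b − n s) φ` where `P' = s`. [folklore] -/
theorem hasDerivAt_phaseFun (P : ShearProfile) (n b : ℤ) {s y : ℝ} (hP : HasDerivAt P s y) :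
    HasDerivAt (fun y : ℝ => cexp (-(2 * Real.pi * I * n * P y)) * cexp (2 * Real.pi * I * b * y))
      ((2 * Real.pi * I * (b - n * s)) * (cexp (-(2 * Real.pi * I * n * P y)) * cexp (2 * Real.pi * I * b * y))) y := by
  have hPc : HasDerivAt (fun y : ℝ => (P y : ℂ)) (s : ℂ) y := hP.ofReal_comp
  have h1 : HasDerivAt (fun y : ℝ => cexp (-(2 * Real.pi * I * n * P y)))
      (cexp (-(2 * Real.pi * I * n * P y)) * (-(2 * Real.pi * I * n * s))) y :=
    ((hPc.const_mul (2 * Real.pi * I * n)).neg).cexp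
  have hyc : HasDerivAt (fun y : ℝ => (y : ℂ)) 1 y := by
    simpa using (hasDerivAt_id y).ofReal_comp
  have h2 : HasDerivAt (fun y : ℝ => cexp (2 * Real.pi * I * b * y))
      (cexp (2 * Real.pi * I * b * y) * (2 * Real.pi * I * b * 1)) y :=
    (hyc.const_mul (2 * Real.pi * I * b)).cexp
  have h : HasDerivAt (fun y : ℝ => cexp (-(2 * Real.pi * I * n * P y)) * cexp (2 * Real.pi * I * b * y))
      (cexp (-(2 * Real.pi * I * n * P y)) * (-(2 * Real.pi * I * n * s)) * cexp (2 * Real.pi * I * b * y) +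
        cexp (-(2 * Real.pi * I * n * P y)) * (cexp (2 * Real.pi * I * b * y) * (2 * Real.pi * I * b * 1))) y :=
    h1.mul h2
  convert h using 1
  ring

/-! ## The circle functions `G_α` of the derivatives `F^{(α)}` -/

variable {d : Type*} [Fintype d] [DecidableEq d]

/-- Two functions on the circle agreeing on all real points are equal. [folklore] -/
theorem circleFun_eq_of_coe {G H : UnitAddCircle → ℂ} (h : ∀ y : ℝ, G (y : UnitAddCircle) = H y) : G = H := by
  funext b
  induction b using QuotientAddGroup.induction_on with
  | H y => exact h y

/-- **`G_0(x_j)` is the un-gauging multiplier** `X(x_j) g_n(x_j) e_b(x)`. [folklore] -/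
theorem multiplier_eq_G_zero (X P : ShearProfile) (n b : ℤ) {G : ℕ → UnitAddCircle → ℂ}
    (hG : ∀ α (y : ℝ), G α (y : UnitAddCircle) = iteratedDeriv α
      (fun y : ℝ => (X y : ℂ) * (cexp (-(2 * Real.pi * I * n * P y)) * cexp (2 * Real.pi * I * b * y))) y) (j : d)
    (x : UnitAddTorus d) :
    (X.onCircle (x j) : ℂ) * twist P n (x j) * mFourier (Pi.single j b) x = G 0 (x j) := by
  rw [Torus.mFourier_single]
  induction x j using QuotientAddGroup.induction_on with
  | H y =>
    rw [hG 0 y, iteratedDeriv_zero, ShearProfile.onCircle_coe, twist_coe, fourier_coe_apply, Complex.ofReal_one, div_one,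
      mul_assoc]

/-- The `G_α` are the circle functions (`Function.Periodic.lift`) of the `F^{(α)}`. [folklore] -/
theorem G_eq_periodicLift (X P : ShearProfile) (n b : ℤ) {G : ℕ → UnitAddCircle → ℂ}
    (hG : ∀ α (y : ℝ), G α (y : UnitAddCircle) = iteratedDeriv α
      (fun y : ℝ => (X y : ℂ) * (cexp (-(2 * Real.pi * I * n * P y)) * cexp (2 * Real.pi * I * b * y))) y) (α : ℕ) :
    G α = (periodic_iteratedDeriv (periodic_multiplierFun X P n b) α).lift := by
  refine circleFun_eq_of_coe fun y => ?_
  rw [hG α y, Function.Periodic.lift_coe]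

omit [DecidableEq d] in
/-- **Smoothness of the derivative multipliers** `x ↦ G_α(x_j)`. [folklore] -/
theorem isSmooth_comp_eval_G (X P : ShearProfile) (n b : ℤ) {G : ℕ → UnitAddCircle → ℂ}
    (hG : ∀ α (y : ℝ), G α (y : UnitAddCircle) = iteratedDeriv α
      (fun y : ℝ => (X y : ℂ) * (cexp (-(2 * Real.pi * I * n * P y)) * cexp (2 * Real.pi * I * b * y))) y) (j : d) (α : ℕ) :
    IsSmooth (fun x : UnitAddTorus d => G α (x j)) := by
  rw [G_eq_periodicLift X P n b hG α]
  refine isSmooth_comp_eval_periodicLift _ ?_ j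
  rw [iteratedDeriv_eq_iterate]
  exact (contDiff_multiplierFun X P n b).iterate_deriv α

/-- **The coefficient relation** `𝓕(G_α(x_j))(q) = (2πi q_j)^α 𝓕(X(x_j) g_n(x_j) e_b)(q)` — hypothesis `hΘd` of the
higher-order expansion. [cite: Grafakos2014, Prop. 3.1.2 (5)] -/
theorem mFourierCoeff_comp_eval_G (X P : ShearProfile) (n b : ℤ) {G : ℕ → UnitAddCircle → ℂ}
    (hG : ∀ α (y : ℝ), G α (y : UnitAddCircle) = iteratedDeriv α
      (fun y : ℝ => (X y : ℂ) * (cexp (-(2 * Real.pi * I * n * P y)) * cexp (2 * Real.pi * I * b * y))) y) (j : d) (α : ℕ)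
    (q : d → ℤ) :
    mFourierCoeff (fun x : UnitAddTorus d => G α (x j)) q = (2 * Real.pi * I * (q j : ℂ)) ^ α *
      mFourierCoeff (fun x : UnitAddTorus d => (X.onCircle (x j) : ℂ) * twist P n (x j) * mFourier (Pi.single j b) x) q := by
  have hF := contDiff_multiplierFun X P n b
  have hX : ContDiff ℝ ∞ (fun y : ℝ => (X y : ℂ)) := ofRealCLM.contDiff.comp X.contDiff
  have hφ : ContDiff ℝ ∞ (fun y : ℝ => cexp (-(2 * Real.pi * I * n * P y)) * cexp (2 * Real.pi * I * b * y)) := by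
    have hP : ContDiff ℝ ∞ (fun y : ℝ => (P y : ℂ)) := ofRealCLM.contDiff.comp P.contDiff
    exact (Complex.contDiff_exp.comp (contDiff_const.mul hP).neg).mul
      (Complex.contDiff_exp.comp (contDiff_const.mul ofRealCLM.contDiff))
  have h0 : (fun x : UnitAddTorus d => (X.onCircle (x j) : ℂ) * twist P n (x j) * mFourier (Pi.single j b) x) =
      fun x : UnitAddTorus d => G 0 (x j) := funext fun x => multiplier_eq_G_zero X P n b hG j x
  rw [h0]
  simp only [G_eq_periodicLift X P n b hG]
  exact mFourierCoeff_comp_eval_periodicLift_iterate (periodic_iteratedDeriv (periodic_multiplierFun X P n b))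
    (fun α y => hasDerivAt_iteratedDeriv_mul hX hφ α y)
    (fun α => by rw [iteratedDeriv_eq_iterate]; exact (hF.iterate_deriv α).continuous) j α q

/-! ## On the flat strips: sup bounds and disjointness -/

omit [Fintype d] [DecidableEq d] in
/-- **Sup bound**: if `P' = s` on an open `U` off which `X` vanishes locally, and the flat Leibniz sequence `p_α`
(`p_0 = X`, `p_{α+1} = p_α' + 2πi(b − n s) p_α`) satisfies `‖p_α‖ ≤ B_α`, then `‖G_α(x_j)‖ ≤ B_α` (the phase is
unimodular). [cite: Grafakos2014, Prop. 3.1.2 (5)] -/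
theorem norm_comp_eval_G_le (X P : ShearProfile) (n b : ℤ) {G : ℕ → UnitAddCircle → ℂ}
    (hG : ∀ α (y : ℝ), G α (y : UnitAddCircle) = iteratedDeriv α
      (fun y : ℝ => (X y : ℂ) * (cexp (-(2 * Real.pi * I * n * P y)) * cexp (2 * Real.pi * I * b * y))) y)
    {U : Set ℝ} {s : ℝ} (hPU : ∀ y ∈ U, HasDerivAt P s y) (hXU : ∀ y, y ∉ U → (fun y : ℝ => (X y : ℂ)) =ᶠ[𝓝 y] 0)
    {p : ℕ → ℝ → ℂ} (hp0 : p 0 = fun y => (X y : ℂ))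
    (hps : ∀ α, p (α + 1) = fun y => deriv (p α) y + (2 * Real.pi * I * (b - n * s)) * p α y)
    {B : ℕ → ℝ} (hB : ∀ α y, ‖p α y‖ ≤ B α) (j : d) (α : ℕ) (x : UnitAddTorus d) : ‖G α (x j)‖ ≤ B α := by
  have hX : ContDiff ℝ ∞ (fun y : ℝ => (X y : ℂ)) := ofRealCLM.contDiff.comp X.contDiff
  obtain ⟨h1, _, _⟩ := iteratedDeriv_mul_eq_of_flat hX hXU (fun y hy => hasDerivAt_phaseFun P n b (hPU y hy)) hp0 hps α
  induction x j using QuotientAddGroup.induction_on with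
  | H y =>
    rw [hG α y, h1]
    simp only
    rw [norm_mul, norm_mul, Complex.norm_exp, Complex.norm_exp]
    have e1 : (-(2 * Real.pi * I * n * P y)).re = 0 := by simp
    have e2 : (2 * Real.pi * I * b * y : ℂ).re = 0 := by simp
    rw [e1, e2, Real.exp_zero, mul_one, mul_one]
    exact hB α y

/-- **Disjointness**: under the same flatness data, if the other cut-off `X⁻` vanishes on `U`, then
`conj(G_α(x_j)) · (X⁻(x_j) g_n(x_j) e_{b'}(x)) = 0` — hypothesis `hdis` of the two-branch expansion. [folklore] -/
theorem conj_comp_eval_G_mul_eq_zero (X P : ShearProfile) (n b : ℤ) {G : ℕ → UnitAddCircle → ℂ}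
    (hG : ∀ α (y : ℝ), G α (y : UnitAddCircle) = iteratedDeriv α
      (fun y : ℝ => (X y : ℂ) * (cexp (-(2 * Real.pi * I * n * P y)) * cexp (2 * Real.pi * I * b * y))) y)
    {U : Set ℝ} {s : ℝ} (hPU : ∀ y ∈ U, HasDerivAt P s y) (hXU : ∀ y, y ∉ U → (fun y : ℝ => (X y : ℂ)) =ᶠ[𝓝 y] 0)
    (Xm : ShearProfile) (hXm : ∀ y ∈ U, Xm y = 0) (b' : ℤ) (j : d) (α : ℕ) (x : UnitAddTorus d) :
    (starRingEnd ℂ) (G α (x j)) * ((Xm.onCircle (x j) : ℂ) * twist P n (x j) * mFourier (Pi.single j b') x) = 0 := by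
  classical
  have hX : ContDiff ℝ ∞ (fun y : ℝ => (X y : ℂ)) := ofRealCLM.contDiff.comp X.contDiff
  -- the flat Leibniz sequence, defined by recursion (a term, not a definition)
  let p : ℕ → ℝ → ℂ := fun α => Nat.rec (fun y => (X y : ℂ))
    (fun _ q => fun y => deriv q y + (2 * Real.pi * I * (b - n * s)) * q y) α
  have hp0 : p 0 = fun y => (X y : ℂ) := rfl
  have hps : ∀ α, p (α + 1) = fun y => deriv (p α) y + (2 * Real.pi * I * (b - n * s)) * p α y := fun α => rfl
  obtain ⟨h1, _, _⟩ := iteratedDeriv_mul_eq_of_flat hX hXU (fun y hy => hasDerivAt_phaseFun P n b (hPU y hy)) hp0 hps α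
  rw [Torus.mFourier_single]
  induction x j using QuotientAddGroup.induction_on with
  | H y =>
    rw [hG α y, h1, ShearProfile.onCircle_coe, mul_assoc (Xm y : ℂ)]
    have h := conj_mul_eq_zero_of_flat hX hXU (fun y hy => hasDerivAt_phaseFun P n b (hPU y hy)) hp0 hps
      (Xm := fun y => (Xm y : ℂ)) (ψ := fun y : ℝ => twist P n (y : UnitAddCircle) * fourier b' (y : UnitAddCircle))
      (fun y hy => by simp only [hXm y hy, Complex.ofReal_zero]) α y
    simpa only using h

end Summit.AnomalousDissipation.AnomalousDissipation.Theorems.SawtoothPulseCascade.K1Slot
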